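import Summits.BirchSwinnertonDyer.BirchSwinnertonDyer.Theorems.ByReductionTypeAtTwoMultTowerNS2LocalLayerGenerator
import Summits.BirchSwinnertonDyer.BirchSwinnertonDyer.Theorems.ByReductionTypeAtTwoMultTowerNS2TwoAdicUnits
import Literature.NumberTheory.GaloisRepresentations.LocalClassFieldAxiom
import Literature.NumberTheory.Automorphic.AdicCompletionLocalField
import Mathlib.FieldTheory.Galois.Infinite
import HarnessLib

/-!
# Route `ByReductionTypeAtTwo`, crux `MultUpperHalfAtTwo` (item stmt-BirchSwinnertonDyer-19922), TOWER road, the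
# «ONE BIT AT A NON-SPLIT 2» rows: KERNEL BRICK 14 — the norm group of the local layer `F_m` of the cyclotomic
# `ℤ₂`-tower is `⟨2⟩ · ±(1 + 2^{m+2}ℤ₂)`, and `q^{2^{m−1}a} = (2^k u)^{2^{m−1}a}` (`u ≡ ±3 mod 8`, `a` odd) is NOT a norm

HONEST FRAMING (cell `bsd-2adic`, run/shared/lean/pub/bsd-2adic/, seat `bsd-2adic-tower-1` GEN 9, HUMAN RULINGS
D-0036 / D-0054 / D-0074): TOOL theorems only (no definition, no named fact, no `sorry`); closes nothing by itself;
nothing booked; BSD is not proved by any of this. Step S5 of the KERNELISATION of the MEMO binder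
`MultTowerNS2.localTowerKerTwoTorsion_le_two_nonsplitTwo_of_tateUnit` (scope memo HOME/tower/SCOPE-hNS2one-kernel-GEN8.md),
in the CFT-light form found by GEN 9: for `v ∋ 2`, `K = ℚ_v`, the local layer field `F_m = K̄_v^{H_m}` (`m ≥ 1`):

* `isGalois_fixedField_localSubgroup_layerSubgroup`, `isCyclic_gal_fixedField_localSubgroup_layerSubgroup` —
  `F_m/K` is Galois with cyclic group (`Γ_{ℚ_v}/H_m ≅ ℤ₂/2^mℤ₂` by BRICK 8's surjectivity of `κ ∘ res_v`);
* `index_range_norm_fixedField_layer` — `[Kˣ : N(F_mˣ)] = 2^m`, the tree's CLASS FIELD AXIOM for cyclic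
  extensions of a local field (`index_range_norm_eq_finrank_of_isCyclic`, Neukirch V (1.1), PROVED in the tree);
* `mem_range_norm_fixedField_layer_iff` — **`N(F_mˣ) = ⟨2⟩ · ±(1 + 2^{m+2}ℤ₂)`** read through any ring
  isomorphism `e : K ≃+* ℚ₂`: `x` is a norm from `F_m` iff `e x = 2^j w` with `w ∈ ℤ₂ˣ`, `w ≡ ±1 (mod 2^{m+2})`.
  Proof: `⊇` from `−1 = N(1 + y_m)`, `2 = N(2 + y_m)` (BRICK 13b) and `1 + 2^{m+2}ℤ₂ ⊆ (ℤ₂ˣ)^{2^m}` (BRICK 12,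
  `z^{2^m} = N(z)`); equality since both subgroups have index `2^m` (BRICK 12 `exists_subgroup_twoAdicLayerNorm`);
* `norm_ne_pow_of_tateUnit` — **for `q ∈ K` with `e q = 2^k u`, `u ≡ 3, 5 (mod 8)`, `a` odd and every `f ∈ F_m`:
  `N_{F_m/K}(f) ≠ q^{2^{m−1} a}`** (its unit part is `≡ ±(1 + 2^{m+1}) ≢ ±1 (mod 2^{m+2})`, BRICK 12) — the
  tower non-norm lemma at level `0`; the relative form `q^{2^{r−1}a} ∉ N(F_{n+r}/F_n)` follows by transitivity
  of the norm (consumer files).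

References: J. Neukirch, *ANT* V (1.1), II (5.7); J.-P. Serre, *Local Fields* XIV §7; scope memo S5.
-/

set_option autoImplicit false
-- the Theorems namespace of this sub repeats the summit name by design (D-0017 nested layout: Summit.<S>.<Sub>)
set_option linter.dupNamespace false

noncomputable section

open scoped Classical IntermediateField

namespace Summit.BirchSwinnertonDyer.BirchSwinnertonDyer.Theorems.MultTowerNS2

open NumberField IsDedekindDomain Field PadicInt Literature.NumberTheory.EllipticCurves
  Literature.NumberTheory.GaloisRepresentations

/-- Two subgroups `T ≤ S` of the same finite index are equal. [folklore] -/
theorem subgroup_eq_of_le_of_index_eq {G : Type*} [Group G] {T S : Subgroup G} (h : T ≤ S)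
    (hidx : T.index = S.index) (h0 : S.index ≠ 0) : T = S := by
  refine le_antisymm h ?_
  have hmul := Subgroup.relIndex_mul_index h
  rw [hidx] at hmul
  have hrel : T.relIndex S = 1 := by
    have : T.relIndex S * S.index = 1 * S.index := by rw [hmul, one_mul]
    exact mul_right_cancel₀ h0 this
  exact Subgroup.relIndex_eq_one.mp hrel

variable {κ : ZpExtension ℚ 2}

/-! ### `F_m / ℚ_v` is cyclic of degree `2^m` -/

/-- **`F_m/ℚ_v` is Galois**: `H_m` is an open normal subgroup of `Γ_{ℚ_v}` (preimage of the normal subgroup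
`κ⁻¹(2^mℤ₂)`), and the fixing subgroup of its fixed field is `H_m` itself. [cite: Washington1997, §13.1] -/
theorem isGalois_fixedField_localSubgroup_layerSubgroup (v : HeightOneSpectrum (𝓞 ℚ)) (m : ℕ) :
    IsGalois (v.adicCompletion ℚ)
      (IntermediateField.fixedField (localSubgroup (κ.layerSubgroup m) (v.adicCompletion ℚ))) := by
  -- (all terms mentioning `localSubgroup` are built BEFORE a `CharZero ℚ_v` instance enters the context: with it,
  -- `Algebra ℚ ℚ_v` would resolve to `DivisionRing.toRatAlgebra` instead of the completion's algebra structure)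
  have hopen := isOpen_localSubgroup (κ.layerSubgroup m) (κ.isOpen_layerSubgroup m) (v.adicCompletion ℚ)
  have hnormal : (localSubgroup (κ.layerSubgroup m) (v.adicCompletion ℚ)).Normal := by
    rw [localSubgroup_eq_comap]; exact Subgroup.Normal.comap inferInstance _
  haveI : CharZero (v.adicCompletion ℚ) :=
    charZero_of_injective_algebraMap (algebraMap ℚ (v.adicCompletion ℚ)).injective
  have hfix := fixingSubgroup_fixedField_of_isOpen _ hopen
  have key := fun x ↦ SetLike.ext_iff.mp hfix x
  refine (InfiniteGalois.normal_iff_isGalois _).mp ?_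
  exact ⟨fun a ha b ↦ (key _).mpr (hnormal.conj_mem a ((key a).mp ha) b)⟩

/-- **`Gal(F_m/ℚ_v)` is cyclic**: it is `Γ_{ℚ_v}/H_m ≅ ℤ₂/2^m ℤ₂ ≅ ℤ/2^m` (`κ ∘ res_v` is onto, BRICK 8; Krull:
`Gal(K̄^H/K) ≅ Γ/H` for closed normal `H`, Mathlib `InfiniteGalois.normalAutEquivQuotient`).
[cite: Washington1997, §13.1] -/
theorem isCyclic_gal_fixedField_localSubgroup_layerSubgroup (hκ : κ.IsCyclotomic) (v : HeightOneSpectrum (𝓞 ℚ))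
    (hv : ((2 : ℕ) : 𝓞 ℚ) ∈ v.asIdeal) (m : ℕ) :
    IsCyclic (IntermediateField.fixedField (localSubgroup (κ.layerSubgroup m) (v.adicCompletion ℚ)) ≃ₐ[v.adicCompletion ℚ]
      IntermediateField.fixedField (localSubgroup (κ.layerSubgroup m) (v.adicCompletion ℚ))) := by
  have hopen : IsOpen (localSubgroup (κ.layerSubgroup m) (v.adicCompletion ℚ) :
      Set (absoluteGaloisGroup (v.adicCompletion ℚ))) :=
    isOpen_localSubgroup (κ.layerSubgroup m) (κ.isOpen_layerSubgroup m) (v.adicCompletion ℚ)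
  have hnormal : (localSubgroup (κ.layerSubgroup m) (v.adicCompletion ℚ)).Normal := by
    rw [localSubgroup_eq_comap]; exact Subgroup.Normal.comap inferInstance _
  have hclosed := (localSubgroup (κ.layerSubgroup m) (v.adicCompletion ℚ)).isClosed_of_isOpen hopen
  -- `H_m = ker (Γ_{ℚ_v} → ℤ₂ → ℤ/2^m)`, a surjection
  let φ : absoluteGaloisGroup (v.adicCompletion ℚ) →* Multiplicative (ZMod (2 ^ m)) :=
    (AddMonoidHom.toMultiplicative (toZModPow (p := 2) m).toAddMonoidHom).comp
      (κ.toContinuousMonoidHom.toMonoidHom.comp (resGal (K := ℚ) (v.adicCompletion ℚ)).toMonoidHom)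
  have hφ : Function.Surjective φ := by
    intro c
    obtain ⟨t, ht⟩ := ZMod.ringHom_surjective (toZModPow (p := 2) m) c.toAdd
    obtain ⟨σ, hσ⟩ := surjective_kappa_comp_resGal hκ v hv (Multiplicative.ofAdd t)
    refine ⟨σ, ?_⟩
    change Multiplicative.ofAdd (toZModPow m (Multiplicative.toAdd
      ((κ.toContinuousMonoidHom.toMonoidHom.comp (resGal (K := ℚ) (v.adicCompletion ℚ)).toMonoidHom) σ))) = c
    rw [hσ, toAdd_ofAdd, ht, ofAdd_toAdd]
  have hker : φ.ker = localSubgroup (κ.layerSubgroup m) (v.adicCompletion ℚ) := by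
    ext σ
    rw [MonoidHom.mem_ker, mem_localSubgroup_iff, ZpExtension.mem_layerSubgroup, ← Ideal.mem_span_singleton,
      ← ker_toZModPow, RingHom.mem_ker]
    constructor
    · intro h
      exact congrArg Multiplicative.toAdd h
    · intro h
      exact congrArg Multiplicative.ofAdd h
  have hcyc0 : IsCyclic (absoluteGaloisGroup (v.adicCompletion ℚ) ⧸ φ.ker) :=
    isCyclic_of_surjective _ (QuotientGroup.quotientKerEquivOfSurjective φ hφ).symm.surjective
  -- the closed normal subgroup `H_m` of `Gal(K̄_v/ℚ_v)` and Krull's `Gal(F_m/ℚ_v) ≅ Γ/H_m`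
  let Hc : ClosedSubgroup (AlgebraicClosure (v.adicCompletion ℚ) ≃ₐ[v.adicCompletion ℚ]
      AlgebraicClosure (v.adicCompletion ℚ)) := ⟨localSubgroup (κ.layerSubgroup m) (v.adicCompletion ℚ), hclosed⟩
  haveI hN : Hc.toSubgroup.Normal := hnormal
  haveI hC : IsCyclic ((AlgebraicClosure (v.adicCompletion ℚ) ≃ₐ[v.adicCompletion ℚ]
      AlgebraicClosure (v.adicCompletion ℚ)) ⧸ Hc.toSubgroup) :=
    isCyclic_of_surjective _ (QuotientGroup.quotientMulEquivOfEq hker).surjective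
  haveI : CharZero (v.adicCompletion ℚ) :=
    charZero_of_injective_algebraMap (algebraMap ℚ (v.adicCompletion ℚ)).injective
  exact isCyclic_of_surjective _ (InfiniteGalois.normalAutEquivQuotient Hc).surjective

/-- **`[ℚ_vˣ : N(F_mˣ)] = 2^m`** — the CLASS FIELD AXIOM (Neukirch V (1.1), `i = 0`, PROVED in the tree:
`index_range_norm_eq_finrank_of_isCyclic`) for the cyclic extension `F_m/ℚ_v` of degree `2^m` of the local field `ℚ_v`.
[cite: NeukirchANT1999, Ch. V §1 Thm. (1.1)] -/
theorem index_range_norm_fixedField_layer (hκ : κ.IsCyclotomic) (v : HeightOneSpectrum (𝓞 ℚ))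
    (hv : ((2 : ℕ) : 𝓞 ℚ) ∈ v.asIdeal) (m : ℕ) :
    (Units.map (Algebra.norm (v.adicCompletion ℚ) :
        IntermediateField.fixedField (localSubgroup (κ.layerSubgroup m) (v.adicCompletion ℚ)) →*
          v.adicCompletion ℚ)).range.index = 2 ^ m := by
  haveI := finiteDimensional_fixedField_localSubgroup_layerSubgroup (κ := κ) v m
  haveI := isGalois_fixedField_localSubgroup_layerSubgroup (κ := κ) v m
  haveI := isCyclic_gal_fixedField_localSubgroup_layerSubgroup hκ v hv m
  rw [index_range_norm_eq_finrank_of_isCyclic (v.adicCompletion ℚ), finrank_fixedField_localSubgroup_layerSubgroup hκ v hv m]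

/-! ### The norm group of `F_m` -/

/-- **`N(F_mˣ) = ⟨2⟩ · ±(1 + 2^{m+2}ℤ₂)`** (`m ≥ 1`), read through a ring isomorphism `e : ℚ_v ≃ ℚ₂` (`p = 2`): a unit
`x` of `ℚ_v` is a norm from the `m`-th local layer `F_m` of the cyclotomic `ℤ₂`-tower iff `e x = 2^j · w` with `w ∈ ℤ₂ˣ`,
`w ≡ ±1 (mod 2^{m+2})`. The norm group CONTAINS `−1 = N(1 + y_m)`, `2 = N(2 + y_m)` (BRICK 13b) and every `2^m`-th
power (`= N` of a base element), hence (Hensel, BRICK 12) the subgroup `e⁻¹(T_m)`; both have index `2^m` (class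
field axiom; BRICK 12), so they are equal. [cite: NeukirchANT1999, Ch. V §1 Thm. (1.1)] -/
theorem mem_range_norm_fixedField_layer_iff (hκ : κ.IsCyclotomic) (v : HeightOneSpectrum (𝓞 ℚ))
    (hv : ((2 : ℕ) : 𝓞 ℚ) ∈ v.asIdeal) {m : ℕ} (hm : 1 ≤ m) (p : ℕ) [Fact p.Prime] (hp : p = 2)
    (e : v.adicCompletion ℚ ≃+* ℚ_[p]) (x : (v.adicCompletion ℚ)ˣ) :
    x ∈ (Units.map (Algebra.norm (v.adicCompletion ℚ) :
        IntermediateField.fixedField (localSubgroup (κ.layerSubgroup m) (v.adicCompletion ℚ)) →*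
          v.adicCompletion ℚ)).range ↔
      ∃ (j : ℤ) (w : ℤ_[p]ˣ), (toZModPow (m + 2) (w : ℤ_[p]) = 1 ∨ toZModPow (m + 2) (w : ℤ_[p]) = -1) ∧
        e (x : v.adicCompletion ℚ) = (p : ℚ_[p]) ^ j * ((w : ℤ_[p]) : ℚ_[p]) := by
  subst hp
  set F := IntermediateField.fixedField (localSubgroup (κ.layerSubgroup m) (v.adicCompletion ℚ)) with hF
  set S := (Units.map (Algebra.norm (v.adicCompletion ℚ) : F →* v.adicCompletion ℚ)).range with hS
  haveI := finiteDimensional_fixedField_localSubgroup_layerSubgroup (κ := κ) v m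
  haveI : CharZero (v.adicCompletion ℚ) :=
    charZero_of_injective_algebraMap (algebraMap ℚ (v.adicCompletion ℚ)).injective
  have hrank : Module.finrank (v.adicCompletion ℚ) F = 2 ^ m := finrank_fixedField_localSubgroup_layerSubgroup hκ v hv m
  -- the subgroup `T = e⁻¹ (⟨2⟩ · ±(1 + 2^{m+2}ℤ₂))` of `ℚ_vˣ`, index `2^m`
  obtain ⟨T₂, hT₂, hT₂idx⟩ := exists_subgroup_twoAdicLayerNorm m
  let eu : (v.adicCompletion ℚ)ˣ →* ℚ_[2]ˣ := Units.map (e : v.adicCompletion ℚ →* ℚ_[2])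
  have heu : Function.Surjective eu := fun u ↦
    ⟨Units.map (e.symm : ℚ_[2] →* v.adicCompletion ℚ) u, Units.ext (by simp [eu])⟩
  set T := T₂.comap eu with hT
  have hTidx : T.index = 2 ^ m := by rw [hT, Subgroup.index_comap_of_surjective _ heu, hT₂idx]
  have hmemT : ∀ y : (v.adicCompletion ℚ)ˣ, y ∈ T ↔ ∃ (j : ℤ) (w : ℤ_[2]ˣ),
      (toZModPow (m + 2) (w : ℤ_[2]) = 1 ∨ toZModPow (m + 2) (w : ℤ_[2]) = -1) ∧
        e (y : v.adicCompletion ℚ) = (2 : ℚ_[2]) ^ j * ((w : ℤ_[2]) : ℚ_[2]) := by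
    intro y
    rw [hT, Subgroup.mem_comap, hT₂]
    rfl
  -- elements of `S`: `-1`, `2`, and `2^m`-th powers
  obtain ⟨ζ, hζ⟩ : ∃ ζ : AlgebraicClosure (v.adicCompletion ℚ), IsPrimitiveRoot ζ (2 ^ (m + 2)) := by
    haveI : NeZero ((2 ^ (m + 2) : ℕ) : AlgebraicClosure (v.adicCompletion ℚ)) :=
      ⟨by rw [Nat.cast_pow]; exact pow_ne_zero _ (by norm_num)⟩
    exact HasEnoughRootsOfUnity.exists_primitiveRoot (AlgebraicClosure (v.adicCompletion ℚ)) (2 ^ (m + 2))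
  obtain ⟨hn1, hn2⟩ := norm_one_add_eq_and_norm_two_add_eq hκ v hv hm hζ
  set y : F := ⟨ζ + ζ⁻¹, add_inv_mem_fixedField_localSubgroup_layerSubgroup hκ v m hζ.pow_eq_one⟩ with hy
  have hmemS : ∀ z : (v.adicCompletion ℚ)ˣ, z ∈ S ↔
      ∃ f : F, Algebra.norm (v.adicCompletion ℚ) f = (z : v.adicCompletion ℚ) := by
    intro z
    rw [hS, MonoidHom.mem_range]
    constructor
    · rintro ⟨f, hf⟩
      exact ⟨(f : F), by simp [← hf]⟩
    · rintro ⟨f, hf⟩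
      have hf0 : f ≠ 0 := by
        rintro rfl
        rw [Algebra.norm_zero] at hf
        exact z.ne_zero hf.symm
      exact ⟨Units.mk0 f hf0, Units.ext (by simp [hf])⟩
  have hneg1 : -1 ∈ S := (hmemS _).mpr ⟨1 + y, by rw [hn1, Units.val_neg, Units.val_one]⟩
  have h2u : (2 : v.adicCompletion ℚ) ≠ 0 := by norm_num
  have htwo : Units.mk0 (2 : v.adicCompletion ℚ) h2u ∈ S := (hmemS _).mpr ⟨2 + y, by rw [hn2, Units.val_mk0]⟩
  have hpow : ∀ z : (v.adicCompletion ℚ)ˣ, z ^ 2 ^ m ∈ S := fun z ↦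
    (hmemS _).mpr ⟨algebraMap (v.adicCompletion ℚ) F z, by
      rw [Algebra.norm_algebraMap, hrank, Units.val_pow_eq_pow_val]⟩
  -- `T ≤ S`
  have hTS : T ≤ S := by
    intro z hz
    obtain ⟨j, w, hw, hz⟩ := (hmemT z).mp hz
    -- `±w = w₀ ^ 2^m`
    obtain ⟨s, w₀, hs, hw₀⟩ : ∃ (s : (v.adicCompletion ℚ)ˣ) (w₀ : ℤ_[2]ˣ), (s = 1 ∨ s = -1) ∧
        ((w : ℤ_[2]) : ℚ_[2]) = e (s : v.adicCompletion ℚ) * (((w₀ ^ 2 ^ m : ℤ_[2]ˣ) : ℤ_[2]) : ℚ_[2]) := by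
      rcases hw with h | h
      · obtain ⟨w₀, hw₀⟩ := exists_units_pow_two_pow_eq_of_toZModPow_eq_one m h
        exact ⟨1, w₀, Or.inl rfl, by rw [hw₀, Units.val_one, map_one, one_mul]⟩
      · have h' : toZModPow (m + 2) (((-w : ℤ_[2]ˣ) : ℤ_[2])) = 1 := by
          rw [Units.val_neg, map_neg, h, neg_neg]
        obtain ⟨w₀, hw₀⟩ := exists_units_pow_two_pow_eq_of_toZModPow_eq_one m h'
        refine ⟨-1, w₀, Or.inr rfl, ?_⟩
        rw [hw₀, Units.val_neg, Units.val_one, map_neg, map_one, Units.val_neg, PadicInt.coe_neg, neg_one_mul,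
          neg_neg]
    -- `z = s · 2^j · (e⁻¹ w₀) ^ 2^m`
    have hw₀1 : ‖((w₀ : ℤ_[2]) : ℚ_[2])‖ = 1 := PadicInt.norm_units w₀
    have hw₀ne : e.symm ((w₀ : ℤ_[2]) : ℚ_[2]) ≠ 0 := by
      rw [ne_eq, map_eq_zero_iff _ e.symm.injective]
      exact norm_pos_iff.mp (by rw [hw₀1]; norm_num)
    let b : (v.adicCompletion ℚ)ˣ := Units.mk0 (e.symm ((w₀ : ℤ_[2]) : ℚ_[2])) hw₀ne
    have hzprod : z = s * (Units.mk0 (2 : v.adicCompletion ℚ) h2u) ^ j * b ^ 2 ^ m := by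
      apply Units.ext
      apply e.injective
      rw [hz, hw₀]
      simp only [Units.val_mul, map_mul, Units.val_zpow_eq_zpow_val, map_zpow₀, Units.val_mk0, map_ofNat,
        Units.val_pow_eq_pow_val, map_pow, RingEquiv.apply_symm_apply, b]
      push_cast
      ring
    rw [hzprod]
    refine S.mul_mem (S.mul_mem ?_ (S.zpow_mem htwo j)) (hpow b)
    rcases hs with rfl | rfl
    · exact S.one_mem
    · exact hneg1
  -- equal indices `2^m`
  have hSidx : S.index = 2 ^ m := index_range_norm_fixedField_layer hκ v hv m
  have hTS' : T = S := subgroup_eq_of_le_of_index_eq hTS (hTidx.trans hSidx.symm) (by rw [hSidx]; positivity)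
  rw [← hTS', hmemT]
  simp only [Nat.cast_ofNat]

/-- **The tower non-norm lemma at level `0`**: for `v ∋ 2`, a ring isomorphism `e : ℚ_v ≃ ℚ₂`, `q ∈ ℚ_v` with
`e q = 2^k · u`, `u ∈ ℤ₂`, `u ≡ 3, 5 (mod 8)` (the Tate parameter and Tate unit of the binder, BRICK 3
`exists_padicInt_tateUnit_of_tateJ_eq`), `a` odd and `m ≥ 1`: **no element of the local layer `F_m` has norm
`q^{2^{m−1} a}`** — its unit part `u^{2^{m−1}a} ≡ ±(1 + 2^{m+1}) (mod 2^{m+2})` is not `≡ ±1` (BRICK 12), while norms from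
`F_m` have unit part `≡ ±1 (mod 2^{m+2})`. This replaces the memo's norm-residue computation `(q, ℚ_{2,m}/ℚ₂) ≠ 1`.
[cite: NeukirchANT1999, Ch. V §1 Thm. (1.1)] -/
theorem norm_ne_pow_of_tateUnit (hκ : κ.IsCyclotomic) (v : HeightOneSpectrum (𝓞 ℚ))
    (hv : ((2 : ℕ) : 𝓞 ℚ) ∈ v.asIdeal) {m : ℕ} (hm : 1 ≤ m) (p : ℕ) [Fact p.Prime] (hp : p = 2)
    (e : v.adicCompletion ℚ ≃+* ℚ_[p]) {q : v.adicCompletion ℚ} {k : ℕ} {u : ℤ_[p]}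
    (hq : e q = (p : ℚ_[p]) ^ k * (u : ℚ_[p])) (hu : toZModPow 3 u = 3 ∨ toZModPow 3 u = 5) {a : ℕ} (ha : Odd a)
    (f : IntermediateField.fixedField (localSubgroup (κ.layerSubgroup m) (v.adicCompletion ℚ))) :
    Algebra.norm (v.adicCompletion ℚ) f ≠ q ^ (2 ^ (m - 1) * a) := by
  subst hp
  intro hf
  obtain ⟨m', rfl⟩ : ∃ m', m = m' + 1 := ⟨m - 1, by omega⟩
  simp only [Nat.add_sub_cancel] at hf
  -- `u` is a unit of `ℤ₂`
  have huu : IsUnit u := by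
    rw [PadicInt.isUnit_iff]
    by_contra hne
    have hlt : ‖u‖ < 1 := lt_of_le_of_ne (PadicInt.norm_le_one u) hne
    rw [PadicInt.norm_lt_one_iff_dvd] at hlt
    obtain ⟨c, rfl⟩ := hlt
    have h8 : toZModPow 3 ((2 : ℤ_[2]) * c) = 2 * toZModPow 3 c := by rw [map_mul, map_ofNat]
    have key : ∀ t : ZMod (2 ^ 3), 2 * t ≠ 3 ∧ 2 * t ≠ 5 := by decide
    rcases hu with h | h
    · exact (key _).1 (h8 ▸ h)
    · exact (key _).2 (h8 ▸ h)
  set U : ℤ_[2]ˣ := huu.unit with hU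
  have hUval : (U : ℤ_[2]) = u := huu.unit_spec
  -- `q ≠ 0` and the norm is a unit of `ℚ_v`
  have hq' : e q = (2 : ℚ_[2]) ^ k * (u : ℚ_[2]) := by simpa using hq
  have hq0 : q ≠ 0 := by
    intro h0
    rw [h0, map_zero, eq_comm, mul_eq_zero] at hq'
    rcases hq' with h | h
    · exact absurd h (pow_ne_zero _ (by norm_num))
    · rw [← hUval] at h
      exact U.ne_zero (PadicInt.coe_eq_zero.mp h)
  haveI := finiteDimensional_fixedField_localSubgroup_layerSubgroup (κ := κ) v (m' + 1)
  have hmem : Units.mk0 (q ^ (2 ^ m' * a)) (pow_ne_zero _ hq0) ∈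
      (Units.map (Algebra.norm (v.adicCompletion ℚ) :
        IntermediateField.fixedField (localSubgroup (κ.layerSubgroup (m' + 1)) (v.adicCompletion ℚ)) →*
          v.adicCompletion ℚ)).range := by
    have hf0 : f ≠ 0 := by
      rintro rfl
      rw [Algebra.norm_zero] at hf
      exact pow_ne_zero _ hq0 hf.symm
    exact ⟨Units.mk0 f hf0, Units.ext (by simp [hf])⟩
  rw [mem_range_norm_fixedField_layer_iff hκ v hv (by omega) 2 rfl e] at hmem
  obtain ⟨j, w, hw, hjw⟩ := hmem
  have hlhs : e (q ^ (2 ^ m' * a)) = (2 : ℚ_[2]) ^ (((k * (2 ^ m' * a) : ℕ)) : ℤ) *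
      (((U ^ (2 ^ m' * a) : ℤ_[2]ˣ) : ℤ_[2]) : ℚ_[2]) := by
    rw [map_pow, hq', mul_pow, ← pow_mul, zpow_natCast, Units.val_pow_eq_pow_val, hUval, PadicInt.coe_pow]
  rw [Units.val_mk0, hlhs] at hjw
  have hjw' : (2 : ℚ_[2]) ^ (((k * (2 ^ m' * a) : ℕ)) : ℤ) * (((U ^ (2 ^ m' * a) : ℤ_[2]ˣ) : ℤ_[2]) : ℚ_[2]) =
      (2 : ℚ_[2]) ^ j * ((w : ℤ_[2]) : ℚ_[2]) := by simpa using hjw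
  obtain ⟨-, hwU⟩ := two_zpow_mul_units_inj hjw'
  -- `w = U ^ (2^m' a)` has residue `±(1 + 2^{m'+2}) ≠ ±1`
  obtain ⟨h1, h2⟩ := toZModPow_pow_ne_one_and_ne_neg_one_of_tateUnit hu ha m'
  rw [← hUval, ← Units.val_pow_eq_pow_val, hwU] at h1 h2
  rcases hw with h | h
  · exact h1 h
  · exact h2 h

end Summit.BirchSwinnertonDyer.BirchSwinnertonDyer.Theorems.MultTowerNS2

end
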